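import Literature.MathematicalPhysics.QuantumFieldTheory.ConformalBootstrap3D.PointKernelK57Data
import Literature.MathematicalPhysics.QuantumFieldTheory.ConformalBootstrap3D.PointKernelParts

/-!
# K57 certificate, kernel part file P5: one-cell head segments 147 in level ranges

The head cells whose kernel evaluation exceeds one `decide` are one-cell segments of `hsegsK57`; each is
checked by `PCert.hPartSideOK` (side conditions) and `PCert.hPartOK` per level range `[n_lo, n_lo + count)`
against an integer claim, the claims summing to `≥ 0` (`PointKernel.partsOK`); soundness is
`PCert.hParts_sound` (`PointKernelParts`).  The part files `P1, P2, …` are mutually independent (each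
imports only the data file); the ranges of one cell may span several of them, and the per-cell
conclusions `hparts_i` / `hcell_i` of those cells are assembled in `PointKernelK57.lean`.
Estimated kernel time 186 s.
-/

set_option maxRecDepth 100000
set_option maxHeartbeats 0

namespace Literature.MathematicalPhysics.QuantumFieldTheory.ConformalBootstrap3D.PointKernelK57

open Literature.MathematicalPhysics.QuantumFieldTheory.ConformalBootstrap3D.PointKernel

/-- levels `[41, 47)` of segment 147: partial lower sum `≥` claim. [folklore] -/
theorem part_147_3 : certK57.hPartOK (PCert.segAt hsegsK57 147) JHK57 41 6 (1284625265016849237417688809405220777) = true := by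
  decide +kernel

/-- levels `[47, 52)` of segment 147: partial lower sum `≥` claim. [folklore] -/
theorem part_147_4 : certK57.hPartOK (PCert.segAt hsegsK57 147) JHK57 47 5 (561722356107473573495561757065915660) = true := by
  decide +kernel

/-- levels `[52, 56)` of segment 147: partial lower sum `≥` claim. [folklore] -/
theorem part_147_5 : certK57.hPartOK (PCert.segAt hsegsK57 147) JHK57 52 4 (254576276145440531769542113502664822) = true := by
  decide +kernel

/-- levels `[56, 57)` of segment 147: partial lower sum `≥` claim. [folklore] -/
theorem part_147_6 : certK57.hPartOK (PCert.segAt hsegsK57 147) JHK57 56 1 (23872026573747764133954961415044208) = true := by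
  decide +kernel

end Literature.MathematicalPhysics.QuantumFieldTheory.ConformalBootstrap3D.PointKernelK57
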